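import Summits.SmoothPoincare4.SmoothPoincare4.Theorems.ConvexBisectionAcyclicBisectionExistsHurwitzReduction
import Summits.SmoothPoincare4.SmoothPoincare4.Theorems.ConvexBisectionAcyclicBisectionExistsBeltPageClause
import Summits.SmoothPoincare4.SmoothPoincare4.Theorems.ConvexBisectionAcyclicBisectionExistsDualHandleCompatibleSplit
import HarnessLib

/-!
# One signed Hurwitz move on fibred data: the dichotomy from the transfer form, and the
# transfer form from the adjacent swap (N1 assembly)
(wave 6, bricks of stub `stub_M2geo` = node N1 of NF4, line `modp-braid-orbits`, crux
`ConvexBisection.AcyclicBisectionExists`, item stmt-SmoothPoincare4-10508; registered sub-goal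
`helper_dichotomy_of_seamClause`)

The registered node N1 (`stub_M2geo`, W6's `node_M2geo`) asks, for fibred data
`(X, h, D, bX, Ψ)` of a word `l` and one signed Hurwitz move `l ↝ l'`, for a Lefschetz link `h'`
of `l'` with data `D'` on some `X' ≅_G X` and the SEAM/BELT DICHOTOMY for `G⁻¹` on the new seam.
This file proves the two outer layers of the N1 design (`N1_HurwitzMove_Design.lean`, G4):
* §1 `dichotomy_of_seamClause` (registered `helper_dichotomy_of_seamClause`) — **the dichotomy
  from the new seam clause through `G`** (the transfer form (M2-T) consumed by
  `hurwitzStep_of_redecomposition`, p134969): the point `G⁻¹ (D'.jA a') = bX.incl y` is, by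
  `D.cover`, an old seam point `D.jA a` (`w a`, `w a'` are positive multiples of `w (Ψ y)`) or an
  old deep belt point `D.jB k b ∉ range D.jA`, on the ray of `pageDir n k` by V4's `belt_pos`
  (p137382).  So (M2-T) ⇒ (M2-geo) (`m2geo_of_transfer`); with W6's
  `redecomposition_of_geometric_of_belt` the two forms are EQUIVALENT.
* §2 `transfer_of_swap` — **(M2-T) from the adjacent swap on old indices** (hypothesis `hswap` =
  the design's geometric node `node_N1_swap`: handles `i`, `i+1` exchanged — `i+1`
  counter-clockwise across the belt page of `i` with class `transvection (v i, s i) (v (i+1))` for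
  `up = true`, `i` clockwise across `i+1` with class `transvection (v (i+1), ¬ s (i+1)) (v i)` for
  `up = false`, pages exchanged, twistings kept, seam clause through `G`): unpack `HurwitzStep`
  (`l = pre ++ a :: b :: suf`), swap with `up :=` the disjunct, re-index along
  `Fin l'.length ≃ Fin l.length` (length identity, then the transposition; V5's `reindexData`),
  compute the letters of `l'` (`transvection_apply`, `sgn (!ε) = −sgn ε`).  This kernel-checks the
  SIGN CONVENTION pairing disjunct 1 of `HurwitzStep` with the counter-clockwise crossing.
  Corollaries (design file): the registered N1 text is `m2geo_of_transfer (transfer_of_swap _)`,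
  (HS) is `hurwitzStep_of_redecomposition (transfer_of_swap _)`.
Everything here is proved; no named facts, no `sorry`.  References: R. E. Gompf, A. I. Stipsicz,
*4-Manifolds and Kirby Calculus* (1999), §8.2 [GompfStipsicz1999]; A. Kas, Pacific J. Math. 89
(1980), §2 [Kas1980]; A. A. Kosinski, *Differential Manifolds* (1993), VI §6 [Kosinski1993].
-/

noncomputable section

set_option linter.dupNamespace false

open scoped Manifold ContDiff Topology
open Set Function

namespace Summit.SmoothPoincare4.SmoothPoincare4.Theorems.AcyclicBisectionExists.ModpBraidOrbits

open Literature.GroupTheory.CombinatorialGroupTheory.SignedHurwitz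
open Literature.Topology.FourManifolds Literature.Topology.FourManifolds.LefschetzBase
open Literature.Topology.FourManifolds.HandleAttachingMap
open ModelsOnFibredOfReach

namespace HurwitzMove

/-! ## §0 Bookkeeping: the letters of `pre ++ x :: y :: suf` -/

/-- Entries of `pre ++ x :: y :: suf` before the two distinguished positions. [folklore] -/
theorem getElem_mid_left {α : Type*} (pre suf : List α) (x y x' y' : α) {j : ℕ}
    (hj : j < pre.length) (h₁ : j < (pre ++ x :: y :: suf).length)
    (h₂ : j < (pre ++ x' :: y' :: suf).length) :
    (pre ++ x :: y :: suf)[j] = (pre ++ x' :: y' :: suf)[j] := by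
  rw [List.getElem_append_left hj, List.getElem_append_left hj]

/-- The entry at the first distinguished position. [folklore] -/
theorem getElem_mid_fst {α : Type*} (pre suf : List α) (x y : α)
    (h₁ : pre.length < (pre ++ x :: y :: suf).length) :
    (pre ++ x :: y :: suf)[pre.length] = x := by
  rw [List.getElem_append_right (le_refl _)]
  simp

/-- The entry at the second distinguished position. [folklore] -/
theorem getElem_mid_snd {α : Type*} (pre suf : List α) (x y : α)
    (h₁ : pre.length + 1 < (pre ++ x :: y :: suf).length) :
    (pre ++ x :: y :: suf)[pre.length + 1] = y := by
  rw [List.getElem_append_right (Nat.le_succ _)]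
  simp

/-- Entries after the two distinguished positions. [folklore] -/
theorem getElem_mid_right {α : Type*} (pre suf : List α) (x y x' y' : α) {j : ℕ}
    (hj : pre.length + 2 ≤ j) (h₁ : j < (pre ++ x :: y :: suf).length)
    (h₂ : j < (pre ++ x' :: y' :: suf).length) :
    (pre ++ x :: y :: suf)[j] = (pre ++ x' :: y' :: suf)[j] := by
  rw [List.getElem_append_right (by omega), List.getElem_append_right (by omega)]
  obtain ⟨m, hm⟩ : ∃ m, j - pre.length = m + 2 := ⟨j - pre.length - 2, by omega⟩
  simp only [hm, List.getElem_cons_succ]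

end HurwitzMove

open HurwitzMove

/-! ## §1 The seam/belt dichotomy from the new seam clause through `G` -/

/-- **The seam/belt dichotomy from the seam clause through `G`.**  Old piece `X` over `Base g`
(family `h` with the `k`-th attaching circle in `page g (pageDir n k)`, data `D`, boundary datum
`bX`, page-preserving `Ψ` on the old seam), new piece `X'` (family `h'`, data `D'`), `G : X ≅ X'`
with `Ψ ∘ ∂G⁻¹` page preserving on the new seam.  Then `G⁻¹` sends a new boundary seam point
either to an old seam point on the same `w`-ray or to an old deep belt point `D.jB k b ∉ range D.jA`
with `w a' ∈ ℝ_{>0} · pageDir n k` (V4 `belt_pos` for the belt ray). [folklore] -/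
theorem dichotomy_of_seamClause {g n n' : ℕ} {h : Fin n → HandleAttachingMap 3 2 (Base g)}
    {h' : Fin n' → HandleAttachingMap 3 2 (Base g)}
    {X : Type} [TopologicalSpace X] [ChartedSpace (EuclideanHalfSpace 4) X]
    {X' : Type} [TopologicalSpace X'] [ChartedSpace (EuclideanHalfSpace 4) X']
    (D : MultiAttachmentData h (𝓡∂ 4) X) (D' : MultiAttachmentData h' (𝓡∂ 4) X')
    (bX : BoundaryData (𝓡∂ 4) X (𝓡 3)) (Ψ : bX.carrier ≃ₘ⟮𝓡 3, 𝓡 3⟯ (bBase g).carrier)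
    (G : X ≃ₘ⟮𝓡∂ 4, 𝓡∂ 4⟯ X')
    (hk : ∀ (k : Fin n) θ, (h k).attachingCircle θ ∈ page g (pageDir n k))
    (hpage : ∀ (y : bX.carrier) (a : ↥(coresComplement h)), bX.incl y = D.jA a →
      ∃ c : ℝ, 0 < c ∧ w g ((bBase g).incl (Ψ y)).1 = (c : ℂ) * w g (a : Base g).1)
    (hseam' : ∀ (y : bX.carrier) (a' : ↥(coresComplement h')), G (bX.incl y) = D'.jA a' →
      ∃ c : ℝ, 0 < c ∧ w g ((bBase g).incl (Ψ y)).1 = (c : ℂ) * w g (a' : Base g).1)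
    (a' : ↥(coresComplement h')) (ha' : G.symm (D'.jA a') ∈ (𝓡∂ 4).boundary X) :
    (∃ a : ↥(coresComplement h), G.symm (D'.jA a') = D.jA a ∧
      ∃ c : ℝ, 0 < c ∧ w g (a' : Base g).1 = (c : ℂ) * w g (a : Base g).1) ∨
    (∃ (k : Fin n) (b : ↥(beltPiece 3 2)), G.symm (D'.jA a') = D.jB k b ∧
      G.symm (D'.jA a') ∉ range D.jA ∧
      ∃ c : ℝ, 0 < c ∧ w g (a' : Base g).1 = (c : ℂ) * pageDir n k) := by
  -- the point of `∂X` under the new seam point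
  obtain ⟨y, hy⟩ : G.symm (D'.jA a') ∈ range bX.incl := by rw [bX.range_incl]; exact ha'
  have hGy : G (bX.incl y) = D'.jA a' := by rw [hy, Diffeomorph.apply_symm_apply]
  obtain ⟨c', hc', hw'⟩ := hseam' y a' hGy
  have hc'0 : (c' : ℂ) ≠ 0 := by exact_mod_cast hc'.ne'
  have e : w g (a' : Base g).1 = (c' : ℂ)⁻¹ * w g ((bBase g).incl (Ψ y)).1 := by
    rw [hw', ← mul_assoc, inv_mul_cancel₀ hc'0, one_mul]
  -- old seam points: same ray
  have seam : ∀ a : ↥(coresComplement h), bX.incl y = D.jA a →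
      (∃ a : ↥(coresComplement h), G.symm (D'.jA a') = D.jA a ∧
        ∃ c : ℝ, 0 < c ∧ w g (a' : Base g).1 = (c : ℂ) * w g (a : Base g).1) := by
    intro a ha
    obtain ⟨c, hc, hw⟩ := hpage y a ha
    refine ⟨a, hy ▸ ha, c / c', div_pos hc hc', ?_⟩
    rw [e, hw, ← mul_assoc]; congr 1; push_cast; field_simp
  rcases D.mem_range_or (bX.incl y) with ⟨a, ha⟩ | ⟨k, b, hb⟩
  · exact Or.inl (seam a ha.symm)
  · by_cases hr : bX.incl y ∈ range D.jA
    · obtain ⟨a, ha⟩ := hr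
      exact Or.inl (seam a ha.symm)
    · right
      obtain ⟨c, hc, hw⟩ := BeltPageClause.belt_pos D bX Ψ.continuous Ψ.toHomeomorph.isOpenMap
        (hk k) hpage hb.symm hr
      refine ⟨k, b, by rw [← hy, hb], by rw [← hy]; exact hr, c / c', div_pos hc hc', ?_⟩
      rw [e, hw, ← mul_assoc]; congr 1; push_cast; field_simp

/-- **(M2-geo) from (M2-T)**: the registered text of `stub_M2geo` follows from the transfer form
(the hypothesis `hM2` of `hurwitzStep_of_redecomposition`) by `dichotomy_of_seamClause`.
[cite: GompfStipsicz1999, §8.2] -/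
theorem m2geo_of_transfer
    (hT : ∀ (g : ℕ) (l l' : IntWord g), HurwitzStep (stdSymp ℤ g) l l' →
      ∀ (X : Type) [TopologicalSpace X] [T2Space X] [SecondCountableTopology X] [CompactSpace X]
        [ChartedSpace (EuclideanHalfSpace 4) X] [IsManifold (𝓡∂ 4) ∞ X]
        (h : Fin l.length → HandleAttachingMap 3 2 (Base g))
        (D : MultiAttachmentData h (𝓡∂ 4) X) (bX : BoundaryData (𝓡∂ 4) X (𝓡 3))
        (Ψ : bX.carrier ≃ₘ⟮𝓡 3, 𝓡 3⟯ (bBase g).carrier),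
        IsLefschetzLink g l h →
        (∀ (y : bX.carrier) (a : ↥(coresComplement h)), bX.incl y = D.jA a →
          ∃ c : ℝ, 0 < c ∧ w g ((bBase g).incl (Ψ y)).1 = (c : ℂ) * w g (a : Base g).1) →
        ∃ (X' : Type) (_ : TopologicalSpace X') (_ : T2Space X') (_ : SecondCountableTopology X')
          (_ : CompactSpace X') (_ : ChartedSpace (EuclideanHalfSpace 4) X')
          (_ : IsManifold (𝓡∂ 4) ∞ X') (h' : Fin l'.length → HandleAttachingMap 3 2 (Base g))
          (D' : MultiAttachmentData h' (𝓡∂ 4) X') (G : X ≃ₘ⟮𝓡∂ 4, 𝓡∂ 4⟯ X'),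
          IsLefschetzLink g l' h' ∧
          ∀ (y : bX.carrier) (a' : ↥(coresComplement h')), G (bX.incl y) = D'.jA a' →
            ∃ c : ℝ, 0 < c ∧ w g ((bBase g).incl (Ψ y)).1 = (c : ℂ) * w g (a' : Base g).1) :
    ∀ (g : ℕ) (l l' : IntWord g), HurwitzStep (stdSymp ℤ g) l l' →
      ∀ (X : Type) [TopologicalSpace X] [T2Space X] [SecondCountableTopology X] [CompactSpace X]
        [ChartedSpace (EuclideanHalfSpace 4) X] [IsManifold (𝓡∂ 4) ∞ X]
        (h : Fin l.length → HandleAttachingMap 3 2 (Base g))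
        (D : MultiAttachmentData h (𝓡∂ 4) X) (bX : BoundaryData (𝓡∂ 4) X (𝓡 3))
        (Ψ : bX.carrier ≃ₘ⟮𝓡 3, 𝓡 3⟯ (bBase g).carrier),
        IsLefschetzLink g l h →
        (∀ (y : bX.carrier) (a : ↥(coresComplement h)), bX.incl y = D.jA a →
          ∃ c : ℝ, 0 < c ∧ w g ((bBase g).incl (Ψ y)).1 = (c : ℂ) * w g (a : Base g).1) →
        ∃ (X' : Type) (_ : TopologicalSpace X') (_ : T2Space X') (_ : SecondCountableTopology X')
          (_ : CompactSpace X') (_ : ChartedSpace (EuclideanHalfSpace 4) X')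
          (_ : IsManifold (𝓡∂ 4) ∞ X') (h' : Fin l'.length → HandleAttachingMap 3 2 (Base g))
          (D' : MultiAttachmentData h' (𝓡∂ 4) X') (G : X ≃ₘ⟮𝓡∂ 4, 𝓡∂ 4⟯ X'),
          IsLefschetzLink g l' h' ∧
          ∀ a' : ↥(coresComplement h'), G.symm (D'.jA a') ∈ (𝓡∂ 4).boundary X →
            (∃ a : ↥(coresComplement h), G.symm (D'.jA a') = D.jA a ∧
              ∃ c : ℝ, 0 < c ∧ w g (a' : Base g).1 = (c : ℂ) * w g (a : Base g).1) ∨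
            (∃ (k : Fin l.length) (b : ↥(beltPiece 3 2)), G.symm (D'.jA a') = D.jB k b ∧
              G.symm (D'.jA a') ∉ range D.jA ∧
              ∃ c : ℝ, 0 < c ∧ w g (a' : Base g).1 = (c : ℂ) * pageDir l.length k) := by
  intro g l l' hst X _ _ _ _ _ _ h D bX Ψ hlink hpage
  obtain ⟨X', _, _, _, _, _, _, h', D', G, hlink', hseam'⟩ := hT g l l' hst X h D bX Ψ hlink hpage
  refine ⟨X', ‹_›, ‹_›, ‹_›, ‹_›, ‹_›, ‹_›, h', D', G, hlink', fun a' ha' => ?_⟩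
  exact dichotomy_of_seamClause D D' bX Ψ G hlink.mem_page hpage hseam' a' ha'

/-! ## §2 (M2-T) from the adjacent swap on old indices -/

/-- **(M2-T) from N1-swap.**  HYPOTHESIS `hswap` = the geometric node N1-swap (design
`node_N1_swap`): for fibred data of a family of `n` handles with cores in the pages of the standard
directions, shadows `v`, twistings coded by `s`, seam and belt clauses, and `i + 1 < n`,
`up : Bool` — a new piece `X'`, the family `h'` unchanged off `{i, i+1}` with the two pages
exchanged, classes `transvection (v i, s i) (v (i+1))`, `v i` (`up`) resp. `v (i+1)`,
`transvection (v (i+1), ¬ s (i+1)) (v i)` (`¬ up`), twistings kept, data `D'`, `G : X ≅ X'` and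
the seam clause through `G`.  CONCLUSION: the transfer form (M2-T) of one signed Hurwitz move —
unpack `l = pre ++ a :: b :: suf`, swap with `up :=` the disjunct (belt clause from V4
`belt_pos`), re-index along `Fin l'.length ≃ Fin l.length` (`finCongr` then `Equiv.swap`; V5's
`reindexData`), read off `IsLefschetzLink g l' _` letter by letter. [cite: GompfStipsicz1999, §8.2] -/
theorem transfer_of_swap
    (hswap : ∀ (g n : ℕ) (X : Type) [TopologicalSpace X] [T2Space X] [SecondCountableTopology X]
      [CompactSpace X] [ChartedSpace (EuclideanHalfSpace 4) X] [IsManifold (𝓡∂ 4) ∞ X]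
      (h : Fin n → HandleAttachingMap 3 2 (Base g)) (D : MultiAttachmentData h (𝓡∂ 4) X)
      (bX : BoundaryData (𝓡∂ 4) X (𝓡 3)) (Ψ : bX.carrier ≃ₘ⟮𝓡 3, 𝓡 3⟯ (bBase g).carrier)
      (v : Fin n → (Fin g ⊕ Fin g → ℤ)) (s : Fin n → Bool),
      (∀ (k : Fin n) θ, (h k).attachingCircle θ ∈ page g (pageDir n k)) →
      (∀ k, shadow g (h k).attachingCircle (h k).continuous_attachingCircle = v k) →
      (∀ k, pageTwisting g (h k).attachingCircle (h k).attachingFraming = if s k then -1 else 1) →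
      (∀ (y : bX.carrier) (a : ↥(coresComplement h)), bX.incl y = D.jA a →
        ∃ c : ℝ, 0 < c ∧ w g ((bBase g).incl (Ψ y)).1 = (c : ℂ) * w g (a : Base g).1) →
      (∀ (y : bX.carrier) (k : Fin n) (b : ↥(beltPiece 3 2)), bX.incl y = D.jB k b →
        bX.incl y ∉ range D.jA →
        ∃ c : ℝ, 0 < c ∧ w g ((bBase g).incl (Ψ y)).1 = (c : ℂ) * pageDir n k) →
      ∀ (i : ℕ) (hi : i + 1 < n) (up : Bool),
      ∃ (X' : Type) (_ : TopologicalSpace X') (_ : T2Space X') (_ : SecondCountableTopology X')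
        (_ : CompactSpace X') (_ : ChartedSpace (EuclideanHalfSpace 4) X')
        (_ : IsManifold (𝓡∂ 4) ∞ X') (h' : Fin n → HandleAttachingMap 3 2 (Base g))
        (D' : MultiAttachmentData h' (𝓡∂ 4) X') (G : X ≃ₘ⟮𝓡∂ 4, 𝓡∂ 4⟯ X'),
        (∀ k : Fin n, k.1 ≠ i → k.1 ≠ i + 1 → h' k = h k) ∧
        (∀ θ, (h' ⟨i + 1, hi⟩).attachingCircle θ ∈ page g (pageDir n i)) ∧
        (∀ θ, (h' ⟨i, Nat.lt_of_succ_lt hi⟩).attachingCircle θ ∈ page g (pageDir n (i + 1))) ∧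
        shadow g (h' ⟨i + 1, hi⟩).attachingCircle (h' ⟨i + 1, hi⟩).continuous_attachingCircle =
          (if up then transvection (stdSymp ℤ g) (v ⟨i, Nat.lt_of_succ_lt hi⟩, s ⟨i, Nat.lt_of_succ_lt hi⟩)
            (v ⟨i + 1, hi⟩) else v ⟨i + 1, hi⟩) ∧
        shadow g (h' ⟨i, Nat.lt_of_succ_lt hi⟩).attachingCircle
            (h' ⟨i, Nat.lt_of_succ_lt hi⟩).continuous_attachingCircle =
          (if up then v ⟨i, Nat.lt_of_succ_lt hi⟩ else
            transvection (stdSymp ℤ g) (v ⟨i + 1, hi⟩, !s ⟨i + 1, hi⟩) (v ⟨i, Nat.lt_of_succ_lt hi⟩)) ∧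
        pageTwisting g (h' ⟨i + 1, hi⟩).attachingCircle (h' ⟨i + 1, hi⟩).attachingFraming =
          (if s ⟨i + 1, hi⟩ then -1 else 1) ∧
        pageTwisting g (h' ⟨i, Nat.lt_of_succ_lt hi⟩).attachingCircle
            (h' ⟨i, Nat.lt_of_succ_lt hi⟩).attachingFraming =
          (if s ⟨i, Nat.lt_of_succ_lt hi⟩ then -1 else 1) ∧
        (∀ (y : bX.carrier) (a' : ↥(coresComplement h')), G (bX.incl y) = D'.jA a' →
          ∃ c : ℝ, 0 < c ∧ w g ((bBase g).incl (Ψ y)).1 = (c : ℂ) * w g (a' : Base g).1)) :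
    ∀ (g : ℕ) (l l' : IntWord g), HurwitzStep (stdSymp ℤ g) l l' →
      ∀ (X : Type) [TopologicalSpace X] [T2Space X] [SecondCountableTopology X] [CompactSpace X]
        [ChartedSpace (EuclideanHalfSpace 4) X] [IsManifold (𝓡∂ 4) ∞ X]
        (h : Fin l.length → HandleAttachingMap 3 2 (Base g))
        (D : MultiAttachmentData h (𝓡∂ 4) X) (bX : BoundaryData (𝓡∂ 4) X (𝓡 3))
        (Ψ : bX.carrier ≃ₘ⟮𝓡 3, 𝓡 3⟯ (bBase g).carrier),
        IsLefschetzLink g l h →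
        (∀ (y : bX.carrier) (a : ↥(coresComplement h)), bX.incl y = D.jA a →
          ∃ c : ℝ, 0 < c ∧ w g ((bBase g).incl (Ψ y)).1 = (c : ℂ) * w g (a : Base g).1) →
        ∃ (X' : Type) (_ : TopologicalSpace X') (_ : T2Space X') (_ : SecondCountableTopology X')
          (_ : CompactSpace X') (_ : ChartedSpace (EuclideanHalfSpace 4) X')
          (_ : IsManifold (𝓡∂ 4) ∞ X') (h' : Fin l'.length → HandleAttachingMap 3 2 (Base g))
          (D' : MultiAttachmentData h' (𝓡∂ 4) X') (G : X ≃ₘ⟮𝓡∂ 4, 𝓡∂ 4⟯ X'),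
          IsLefschetzLink g l' h' ∧
          ∀ (y : bX.carrier) (a' : ↥(coresComplement h')), G (bX.incl y) = D'.jA a' →
            ∃ c : ℝ, 0 < c ∧ w g ((bBase g).incl (Ψ y)).1 = (c : ℂ) * w g (a' : Base g).1 := by
  intro g l l' hst X _ _ _ _ _ _ h D bX Ψ hlink hpage
  obtain ⟨pre, suf, a, b, hl, hl'⟩ := hst
  subst hl
  -- the two positions `|pre|`, `|pre| + 1`
  have hiB : pre.length + 1 < (pre ++ a :: b :: suf).length := by simp
  have hiA : pre.length < (pre ++ a :: b :: suf).length := Nat.lt_of_succ_lt hiB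
  have ha : (pre ++ a :: b :: suf).get ⟨pre.length, hiA⟩ = a := getElem_mid_fst pre suf a b hiA
  have hb : (pre ++ a :: b :: suf).get ⟨pre.length + 1, hiB⟩ = b := getElem_mid_snd pre suf a b hiB
  -- the belt clause (V4) and the swap
  have hbelt : ∀ (y : bX.carrier) (k : Fin (pre ++ a :: b :: suf).length) (b' : ↥(beltPiece 3 2)),
      bX.incl y = D.jB k b' → bX.incl y ∉ range D.jA →
      ∃ c : ℝ, 0 < c ∧ w g ((bBase g).incl (Ψ y)).1 = (c : ℂ) * pageDir (pre ++ a :: b :: suf).length k :=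
    fun y k b' hy hdeep => BeltPageClause.belt_pos D bX Ψ.continuous Ψ.toHomeomorph.isOpenMap
      (hlink.mem_page k) hpage hy hdeep
  have key := fun up : Bool => hswap g (pre ++ a :: b :: suf).length X h D bX Ψ
    (fun k => ((pre ++ a :: b :: suf).get k).1) (fun k => ((pre ++ a :: b :: suf).get k).2)
    hlink.mem_page hlink.shadow_eq hlink.twisting_eq hpage hbelt pre.length hiB up
  -- the new word, with its disjunct
  have main : ∀ (up : Bool) (x y : (Fin g ⊕ Fin g → ℤ) × Bool),
      x.1 = (if up then transvection (stdSymp ℤ g) (a.1, a.2) b.1 else b.1) →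
      y.1 = (if up then a.1 else transvection (stdSymp ℤ g) (b.1, !b.2) a.1) →
      x.2 = b.2 → y.2 = a.2 →
      ∃ (X' : Type) (_ : TopologicalSpace X') (_ : T2Space X') (_ : SecondCountableTopology X')
        (_ : CompactSpace X') (_ : ChartedSpace (EuclideanHalfSpace 4) X')
        (_ : IsManifold (𝓡∂ 4) ∞ X')
        (h' : Fin (pre ++ x :: y :: suf).length → HandleAttachingMap 3 2 (Base g))
        (D' : MultiAttachmentData h' (𝓡∂ 4) X') (G : X ≃ₘ⟮𝓡∂ 4, 𝓡∂ 4⟯ X'),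
        IsLefschetzLink g (pre ++ x :: y :: suf) h' ∧
        ∀ (yy : bX.carrier) (a' : ↥(coresComplement h')), G (bX.incl yy) = D'.jA a' →
          ∃ c : ℝ, 0 < c ∧ w g ((bBase g).incl (Ψ yy)).1 = (c : ℂ) * w g (a' : Base g).1 := by
    intro up x y hx1 hy1 hx2 hy2
    obtain ⟨X', _, _, _, _, _, _, h', D', G, hother, hpB, hpA, hshB, hshA, htwB, htwA, hseam'⟩ :=
      key up
    have hlen : (pre ++ x :: y :: suf).length = (pre ++ a :: b :: suf).length := by simp
    -- re-indexing: length identity then the transposition of the two positions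
    obtain ⟨e, he⟩ : ∃ e : Fin (pre ++ x :: y :: suf).length ≃ Fin (pre ++ a :: b :: suf).length,
        e = (finCongr hlen).trans (Equiv.swap ⟨pre.length, hiA⟩ ⟨pre.length + 1, hiB⟩) := ⟨_, rfl⟩
    have heA : ∀ j : Fin (pre ++ x :: y :: suf).length, j.1 = pre.length →
        e j = ⟨pre.length + 1, hiB⟩ := by
      intro j hj
      have : finCongr hlen j = ⟨pre.length, hiA⟩ := Fin.ext hj
      rw [he, Equiv.trans_apply, this, Equiv.swap_apply_left]
    have heB : ∀ j : Fin (pre ++ x :: y :: suf).length, j.1 = pre.length + 1 →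
        e j = ⟨pre.length, hiA⟩ := by
      intro j hj
      have : finCongr hlen j = ⟨pre.length + 1, hiB⟩ := Fin.ext hj
      rw [he, Equiv.trans_apply, this, Equiv.swap_apply_right]
    have heO : ∀ j : Fin (pre ++ x :: y :: suf).length, j.1 ≠ pre.length → j.1 ≠ pre.length + 1 →
        e j = ⟨j.1, hlen ▸ j.2⟩ := by
      intro j h1 h2
      have h1' : finCongr hlen j ≠ ⟨pre.length, hiA⟩ := fun c => h1 (congrArg Fin.val c)
      have h2' : finCongr hlen j ≠ ⟨pre.length + 1, hiB⟩ := fun c => h2 (congrArg Fin.val c)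
      rw [he, Equiv.trans_apply, Equiv.swap_apply_of_ne_of_ne h1' h2']
      rfl
    -- the entries of the two words
    have hxj : ∀ j : Fin (pre ++ x :: y :: suf).length, j.1 = pre.length →
        (pre ++ x :: y :: suf).get j = x := by
      intro j hj
      rw [List.get_eq_getElem]
      simp only [hj]
      exact getElem_mid_fst pre suf x y (hj ▸ j.2)
    have hyj : ∀ j : Fin (pre ++ x :: y :: suf).length, j.1 = pre.length + 1 →
        (pre ++ x :: y :: suf).get j = y := by
      intro j hj
      rw [List.get_eq_getElem]
      simp only [hj]
      exact getElem_mid_snd pre suf x y (hj ▸ j.2)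
    have hoj : ∀ j : Fin (pre ++ x :: y :: suf).length, j.1 ≠ pre.length → j.1 ≠ pre.length + 1 →
        (pre ++ x :: y :: suf).get j = (pre ++ a :: b :: suf).get ⟨j.1, hlen ▸ j.2⟩ := by
      intro j h1 h2
      rw [List.get_eq_getElem, List.get_eq_getElem]
      rcases Nat.lt_or_ge j.1 pre.length with hlt | hge
      · exact getElem_mid_left pre suf x y a b hlt _ _
      · exact getElem_mid_right pre suf x y a b (by omega) _ _
    have hfam : ∀ j, (h' ∘ ⇑e) j = h' (e j) := fun _ => rfl
    refine ⟨X', ‹_›, ‹_›, ‹_›, ‹_›, ‹_›, ‹_›, h' ∘ e, D'.reindexData e hfam, G, ⟨?_, ?_, ?_, ?_⟩, ?_⟩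
    · exact (D'.reindexData e hfam).disjoint
    · -- pages
      intro j θ
      have hdir : pageDir (pre ++ x :: y :: suf).length j.1 = pageDir (pre ++ a :: b :: suf).length j.1 :=
        congrArg (fun m => pageDir m j.1) hlen
      rw [hdir, Function.comp_apply]
      by_cases h1 : j.1 = pre.length
      · rw [heA j h1, h1]; exact hpB θ
      by_cases h2 : j.1 = pre.length + 1
      · rw [heB j h2, h2]; exact hpA θ
      · rw [heO j h1 h2, hother _ h1 h2]; exact hlink.mem_page ⟨j.1, hlen ▸ j.2⟩ θ
    · -- shadows
      intro j
      by_cases h1 : j.1 = pre.length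
      · have hj : (h' ∘ ⇑e) j = h' ⟨pre.length + 1, hiB⟩ := by rw [Function.comp_apply, heA j h1]
        rw [hj, hshB, hxj j h1, hx1, ha, hb]
      by_cases h2 : j.1 = pre.length + 1
      · have hj : (h' ∘ ⇑e) j = h' ⟨pre.length, hiA⟩ := by rw [Function.comp_apply, heB j h2]
        rw [hj, hshA, hyj j h2, hy1, ha, hb]
      · have hj : (h' ∘ ⇑e) j = h ⟨j.1, hlen ▸ j.2⟩ := by
          rw [Function.comp_apply, heO j h1 h2, hother _ h1 h2]
        rw [hj, hlink.shadow_eq ⟨j.1, hlen ▸ j.2⟩, hoj j h1 h2]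
    · -- twistings
      intro j
      by_cases h1 : j.1 = pre.length
      · have hj : (h' ∘ ⇑e) j = h' ⟨pre.length + 1, hiB⟩ := by rw [Function.comp_apply, heA j h1]
        rw [hj, htwB, hxj j h1, hx2, hb]
      by_cases h2 : j.1 = pre.length + 1
      · have hj : (h' ∘ ⇑e) j = h' ⟨pre.length, hiA⟩ := by rw [Function.comp_apply, heB j h2]
        rw [hj, htwA, hyj j h2, hy2, ha]
      · have hj : (h' ∘ ⇑e) j = h ⟨j.1, hlen ▸ j.2⟩ := by
          rw [Function.comp_apply, heO j h1 h2, hother _ h1 h2]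
        rw [hj, hlink.twisting_eq ⟨j.1, hlen ▸ j.2⟩, hoj j h1 h2]
    · -- the seam clause through `G` survives re-indexing (same base points)
      intro yy a' hy
      rw [MultiAttachmentData.reindexData_jA] at hy
      exact hseam' yy ⟨(a' : Base g), (mem_coresComplement_iff_of_eq_comp e hfam).1 a'.2⟩ hy
  rcases hl' with rfl | rfl
  · have hx1 : (b.1 + (sgn a.2 * stdSymp ℤ g a.1 b.1) • a.1, b.2).1 =
        (if true then transvection (stdSymp ℤ g) (a.1, a.2) b.1 else b.1) := by
      rw [if_pos rfl, transvection_apply]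
    have hy1 : a.1 = (if true then a.1 else transvection (stdSymp ℤ g) (b.1, !b.2) a.1) := by
      rw [if_pos rfl]
    exact main true (b.1 + (sgn a.2 * stdSymp ℤ g a.1 b.1) • a.1, b.2) a hx1 hy1 rfl rfl
  · have hx1 : b.1 = (if false then transvection (stdSymp ℤ g) (a.1, a.2) b.1 else b.1) := by
      rw [if_neg Bool.false_ne_true]
    have hy1 : (a.1 - (sgn b.2 * stdSymp ℤ g b.1 a.1) • b.1, a.2).1 =
        (if false then a.1 else transvection (stdSymp ℤ g) (b.1, !b.2) a.1) := by
      rw [if_neg Bool.false_ne_true, transvection_apply, ModelsOnFibredOfReach.sgn_not, neg_mul, neg_smul,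
        sub_eq_add_neg]
    exact main false b (a.1 - (sgn b.2 * stdSymp ℤ g b.1 a.1) • b.1, a.2) hx1 hy1 rfl rfl

/-- **The seam/belt dichotomy from the seam clause through `G`, registered form** (sub-goal
`helper_dichotomy_of_seamClause` of `stub_M2geo`): (M2-T) ⇒ (M2-geo) pointwise, for any old
family with the `k`-th attaching circle in the page of `pageDir n k` (V4 `belt_pos` for the belt
ray). [folklore] -/
theorem helper_dichotomy_of_seamClause : ∀ (g n n' : ℕ) (h : Fin n → Literature.Topology.FourManifolds.HandleAttachingMap 3 2 (Literature.Topology.FourManifolds.LefschetzBase.Base g)) (h' : Fin n' → Literature.Topology.FourManifolds.HandleAttachingMap 3 2 (Literature.Topology.FourManifolds.LefschetzBase.Base g)) (X : Type) [TopologicalSpace X] [ChartedSpace (EuclideanHalfSpace 4) X] (X' : Type) [TopologicalSpace X'] [ChartedSpace (EuclideanHalfSpace 4) X'] (D : Literature.Topology.FourManifolds.HandleAttachingMap.MultiAttachmentData h (𝓡∂ 4) X) (D' : Literature.Topology.FourManifolds.HandleAttachingMap.MultiAttachmentData h' (𝓡∂ 4) X') (bX : Literature.Topology.FourManifolds.BoundaryData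 (𝓡∂ 4) X (𝓡 3)) (Ψ : bX.carrier ≃ₘ⟮𝓡 3, 𝓡 3⟯ (Literature.Topology.FourManifolds.LefschetzBase.bBase g).carrier) (G : X ≃ₘ⟮𝓡∂ 4, 𝓡∂ 4⟯ X'), (∀ (k : Fin n) (θ : Metric.sphere (0 : EuclideanSpace ℝ (Fin 2)) 1), (h k).attachingCircle θ ∈ Literature.Topology.FourManifolds.LefschetzBase.page g (Literature.Topology.FourManifolds.LefschetzBase.pageDir n k)) → (∀ (y : bX.carrier) (a : ↥(Literature.Topology.FourManifolds.HandleAttachingMap.coresComplement h)), bX.incl y = D.jA a → ∃ c : ℝ, 0 < c ∧ Literature.Topology.FourManifolds.LefschetzBase.w g ((Literature.Topology.FourManifolds.LefschetzBase.bBase g).incl (Ψ y)).1 = (c : ℂ) * Literature.Topology.FourManifolds.LefschetzBase.w g (a : Literature.Topology.FourManifolds.LefschetzBase.Base g).1) → (∀ (y : bX.carrier) (a' : ↥(Literature.Topology.FourManifolds.HandleAttachingMap.coresComplement h')), G (bX.incl y) = D'.jA a' → ∃ c : ℝ, 0 < c ∧ Literature.Topology.FourManifolds.LefschetzBase.w g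 ((Literature.Topology.FourManifolds.LefschetzBase.bBase g).incl (Ψ y)).1 = (c : ℂ) * Literature.Topology.FourManifolds.LefschetzBase.w g (a' : Literature.Topology.FourManifolds.LefschetzBase.Base g).1) → ∀ a' : ↥(Literature.Topology.FourManifolds.HandleAttachingMap.coresComplement h'), G.symm (D'.jA a') ∈ (𝓡∂ 4).boundary X → (∃ a : ↥(Literature.Topology.FourManifolds.HandleAttachingMap.coresComplement h), G.symm (D'.jA a') = D.jA a ∧ ∃ c : ℝ, 0 < c ∧ Literature.Topology.FourManifolds.LefschetzBase.w g (a' : Literature.Topology.FourManifolds.LefschetzBase.Base g).1 = (c : ℂ) * Literature.Topology.FourManifolds.LefschetzBase.w g (a : Literature.Topology.FourManifolds.LefschetzBase.Base g).1) ∨ (∃ (k : Fin n) (b : ↥(Literature.Topology.FourManifolds.beltPiece 3 2)), G.symm (D'.jA a') = D.jB k b ∧ G.symm (D'.jA a') ∉ Set.range D.jA ∧ ∃ c : ℝ, 0 < c ∧ Literature.Topology.FourManifolds.LefschetzBase.w g (a' : Literature.Topology.FourManifolds.LefschetzBase.Base g).1 = (c : ℂ) * Literature.Topology.FourManifolds.LefschetzBase.pageDir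 n k) :=
  fun _ _ _ _ _ _ _ _ _ _ _ D D' bX Ψ G hk hpage hseam' a' ha' =>
    dichotomy_of_seamClause D D' bX Ψ G hk hpage hseam' a' ha'

end Summit.SmoothPoincare4.SmoothPoincare4.Theorems.AcyclicBisectionExists.ModpBraidOrbits

end
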